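import Summits.CriticalPhenomena.PercolationContinuityZ3.Theorems.Transplant.AutChartOrbitsOneLampAutTranslations
import Mathlib.Algebra.Group.Pi.Lemmas
import HarnessLib

/-!
# THE AUT-LEVEL ONE-LAMP NO-GO: no group acting on a one-lamp frame by label-preserving bijections with finitely many orbits carries a chart with
# exact single-edge steps

builds on p205010 (kernel theorem, internal audit signed; external expert review pending) — nothing in this file uses p205010: it is a NEGATIVE (scope)
record about the HYPOTHESES of the orbit theorem (N3-a) and of the one-type nodes (U, U_s, N1, N2), pure group theory / combinatorics, no percolation
statement, nothing about any `@[conjecture]` (in particular nothing about `BenjaminiSchramm1996_conj4_endState`).  Lane `prim-bschramm`, seat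
`prim-bschramm-p3` gen 36 (DESIGN OWNER; `P3-NILPOTENT.md` §29.3).  Helper file (`--supports stmt-CriticalPhenomena-4575 --as helper`).  Def-free.

THE THEOREM (`OneLampFrame.LabelAction.no_single_edge_steps`).  `F : OneLampFrame Γ` (a permutational-wreath-type group `Γ = L·H`, `H` torsion, one lamp
letter `s`, positions independent), `𝒜` ANY group acting on `Γ` by label-preserving bijections («AutChartOrbitsOneLampAutDefs» `LabelAction`: `α·(γh) = (α·γ)h`
for `h ∈ H`, `α·(γs) = (α·γ)s^{±1}`) with FINITELY MANY ORBITS (a finite `R` with `𝒜·R = Γ`), `φ : Γ → ℤ²` an `𝒜`-EQUIVARIANT chart (`φ(α·γ) = φ γ + c α`),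
`N ≥ 1`.  Then it is FALSE that at every vertex `γ` each of the four vectors `± N e₀, ± N e₁` is `φ(γ x) − φ γ` for a letter `x ∈ H ∪ {s, s⁻¹}`.
This is «AutChartOrbitsOneLampNoGo» `not_cosetSteps` (p588546: `𝒜 = Γ₀ ≤ Γ` of finite index) for an ARBITRARY acting group — caveat (α) of the lane's
record: on `Cay(ℤ ≀_X 𝔊; a,b,c,d,s)` every group of graph automorphisms is such an `𝒜` once LABEL RIGIDITY is known (the companion files
«GrigorchukLamplighterLabelRigidity» / «…StandardGensNoSkeleton»).

PROOF (§1–§3).  §1 the character calculus (`c` is additive and conjugation invariant) and the LINEAR PART `Φ m := φ(m^T) − φ 1` built from the uniform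
pure translations of «…AutTranslations» (`Φ` is additive on `L`, `φ(m^T γ) − φ γ = Φ m`, and `Φ(h s h⁻¹) = sgn α h · Φ((T h) s (T h)⁻¹)` by conjugation
invariance); §2 the DEFECT `h γ := T φ γ − Φ(lam γ)` is CONSTANT ON ORBITS: `h(α γ) − h γ = κ α` does not depend on `γ` (the left rule), `κ` is a
homomorphism to `ℤ²` vanishing on pure translations, on squares of tree-trivial elements («…AutSigns» `exists_sq_smul_eq_mul`) and hence — `H` being
torsion — everywhere; §3 feed «AutChartOrbitsOneLampNoGo» `no_four_directions` (p588546 §1, unchanged) on the index set `R` with `h`, `m r := Φ(pos r)`,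
`sp/sm r :=` the representatives of `r s^{±1}`: tree letters are zero-drift slots `h r′ − h r`, the lamp letter gives `± m r + (h r′ − h r)`, scale `T N`.
[cite: BenjaminiSchramm1996, Conj. 4; §2 (almost transitive graphs)] [cite: BartholdiErschler2012, §2 (permutational wreath products)]
[cite: KozmaNitzan2024, §4 p. 16 (Lemma 8)]
-/

namespace Summit.CriticalPhenomena.PercolationContinuityZ3.Theorems.Transplant

namespace OneLampFrame

namespace LabelAction

variable {Γ : Type} [Group Γ] {F : OneLampFrame Γ} {𝒜 : Type} [Group 𝒜] [MulAction 𝒜 Γ] (A : F.LabelAction 𝒜)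

/-! ### §1 The character and the linear part -/

/-- `n • v = 0` with `n ≠ 0` forces `v = 0` in `ℤ²`. [folklore] -/
theorem eq_zero_of_nsmul_eq_zero {n : ℕ} (hn : n ≠ 0) {v : Fin 2 → ℤ} (h : n • v = 0) : v = 0 := by
  funext j
  have hj := congrFun h j
  simp only [Pi.smul_apply, Pi.zero_apply, nsmul_eq_mul] at hj
  rcases mul_eq_zero.mp hj with h' | h'
  · exact absurd (by exact_mod_cast h') hn
  · exact h'

section Chart

variable (φ : Γ → Fin 2 → ℤ) (c : 𝒜 → Fin 2 → ℤ) (hφ : ∀ (α : 𝒜) (γ : Γ), φ (α • γ) = φ γ + c α)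
include hφ

/-- `c` is additive. [folklore] -/
theorem char_mul (α β : 𝒜) : c (α * β) = c α + c β := by
  have h := hφ (α * β) 1
  rw [mul_smul, hφ, hφ, add_assoc] at h
  rw [← add_left_cancel h, add_comm]

/-- `c α⁻¹ = −c α` (and, on the way, the character of the identity vanishes). [folklore] -/
theorem char_inv (α : 𝒜) : c α⁻¹ = -c α := by
  have h1 : c 1 = 0 := by
    have h := hφ 1 1
    rw [one_smul] at h
    exact (add_eq_left.mp h.symm)
  have h := char_mul φ c hφ α⁻¹ α
  rw [inv_mul_cancel, h1] at h
  exact eq_neg_of_add_eq_zero_left h.symm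

/-- `c` is conjugation invariant. [folklore] -/
theorem char_conj (α β : 𝒜) : c (α * β * α⁻¹) = c β := by
  rw [char_mul φ c hφ, char_mul φ c hφ, char_inv φ c hφ]; abel

/-- The character of a pure translation: `φ(m γ) − φ γ = c β` when `β` translates by `m`. [folklore] -/
theorem char_of_translation {β : 𝒜} {m : Γ} (hβ : ∀ γ : Γ, β • γ = m * γ) (γ : Γ) : φ (m * γ) - φ γ = c β := by
  rw [← hβ, hφ]; abel

/-- Iterating a pure translation: `φ(m^j γ) − φ γ = j • c β`. [folklore] -/
theorem char_pow_of_translation {β : 𝒜} {m : Γ} (hβ : ∀ γ : Γ, β • γ = m * γ) (j : ℕ) (γ : Γ) : φ (m ^ j * γ) - φ γ = j • c β := by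
  induction j with
  | zero => simp
  | succ j ih =>
    have h1 := char_of_translation φ c hφ hβ (m ^ j * γ)
    rw [← mul_assoc, ← pow_succ'] at h1
    rw [succ_nsmul, ← ih, ← h1]; abel

/-- **The linear part is well defined**: if EVERY lamp has a pure translation by its `T`-th power in `𝒜`, then `φ(m^T γ) − φ γ = φ(m^T) − φ 1` for all
`γ` (both equal the character of the translation). [folklore] -/
theorem linear_eq {T : ℕ} (hT : ∀ m ∈ F.L, ∃ β : 𝒜, ∀ γ : Γ, β • γ = m ^ T * γ) {m : Γ} (hm : m ∈ F.L) (γ : Γ) :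
    φ (m ^ T * γ) - φ γ = φ (m ^ T) - φ 1 := by
  obtain ⟨β, hβ⟩ := hT m hm
  rw [char_of_translation φ c hφ hβ, ← char_of_translation φ c hφ hβ 1, mul_one]

/-- **The linear part is additive on `L`.** [folklore] -/
theorem linear_mul {T : ℕ} (hT : ∀ m ∈ F.L, ∃ β : 𝒜, ∀ γ : Γ, β • γ = m ^ T * γ) {m₁ m₂ : Γ} (hm₁ : m₁ ∈ F.L) (hm₂ : m₂ ∈ F.L) :
    φ ((m₁ * m₂) ^ T) - φ 1 = (φ (m₁ ^ T) - φ 1) + (φ (m₂ ^ T) - φ 1) := by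
  have hc : Commute m₁ m₂ := F.comm m₁ hm₁ m₂ hm₂
  have e : (m₁ * m₂) ^ T = m₁ ^ T * (m₂ ^ T * 1) := by rw [hc.mul_pow, mul_one]
  rw [e, ← linear_eq φ c hφ hT hm₁ (m₂ ^ T * 1), ← linear_eq φ c hφ hT hm₂ 1]; abel

/-- The linear part of an inverse. [folklore] -/
theorem linear_inv {T : ℕ} (hT : ∀ m ∈ F.L, ∃ β : 𝒜, ∀ γ : Γ, β • γ = m ^ T * γ) {m : Γ} (hm : m ∈ F.L) :
    φ (m⁻¹ ^ T) - φ 1 = -(φ (m ^ T) - φ 1) := by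
  have h := linear_mul φ c hφ hT hm (F.L.inv_mem hm)
  rw [mul_inv_cancel, one_pow, sub_self] at h
  exact eq_neg_of_add_eq_zero_right h.symm

/-- The linear part of an integer power of a lamp: `φ((m^k)^T) − φ 1 = k • (φ(m^T) − φ 1)`. [folklore] -/
theorem linear_zpow {T : ℕ} (hT : ∀ m ∈ F.L, ∃ β : 𝒜, ∀ γ : Γ, β • γ = m ^ T * γ) {m : Γ} (hm : m ∈ F.L) (k : ℤ) :
    φ ((m ^ k) ^ T) - φ 1 = k • (φ (m ^ T) - φ 1) := by
  induction k using Int.induction_on with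
  | zero => simp
  | succ k ih => rw [zpow_add_one, linear_mul φ c hφ hT (F.L.zpow_mem hm k) hm, ih, add_smul, one_smul]
  | pred k ih =>
    rw [zpow_sub_one, linear_mul φ c hφ hT (F.L.zpow_mem hm _) (F.L.inv_mem hm), ih, linear_inv φ c hφ hT hm, sub_smul,
      one_smul, ← sub_eq_add_neg]

include A in
/-- **The sign relation**: `Φ(h s h⁻¹) = sgn α h · Φ((T_α h) s (T_α h)⁻¹)` — conjugation invariance of the character applied to the translation by
`(h s h⁻¹)^T` and its conjugate by `α` (the left rule). [folklore] -/
theorem linear_conj {T : ℕ} (hT : ∀ m ∈ F.L, ∃ β : 𝒜, ∀ γ : Γ, β • γ = m ^ T * γ) (α : 𝒜) {h : Γ} (hh : h ∈ F.H) :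
    φ ((h * F.s * h⁻¹) ^ T) - φ 1 =
      A.sgn α h • (φ ((A.treePart α * h * F.s * (A.treePart α * h)⁻¹) ^ T) - φ 1) := by
  obtain ⟨β, hβ⟩ := hT _ (F.conj_mem_L F.s_mem h)
  set y : Γ := A.treePart α * h * F.s * (A.treePart α * h)⁻¹ with hy
  have hyL : y ∈ F.L := F.conj_mem_L F.s_mem _
  -- `α β α⁻¹` translates by `y^{ε T}`
  have hc : ∀ γ : Γ, (α * β * α⁻¹) • γ = y ^ (A.sgn α h * T) * γ := fun γ => by
    rw [mul_smul, mul_smul, hβ, ← zpow_natCast, A.smul_conj_zpow_mul α hh, smul_inv_smul]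
  have e1 : φ ((h * F.s * h⁻¹) ^ T) - φ 1 = c β := by
    have := char_of_translation φ c hφ hβ 1; rwa [mul_one] at this
  have e2 : φ (y ^ (A.sgn α h * T) * 1) - φ 1 = c β := by
    rw [char_of_translation φ c hφ hc 1, char_conj φ c hφ]
  rw [mul_one] at e2
  rw [e1, ← e2]
  rcases A.sgn_eq_or α h with hε | hε
  · rw [hε, one_mul, zpow_natCast, one_smul]
  · rw [hε, neg_one_mul, neg_one_smul, show y ^ (-(T : ℤ)) = (y⁻¹) ^ T by rw [zpow_neg, zpow_natCast, inv_pow],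
      linear_inv φ c hφ hT hyL]

end Chart

/-! ### §2 The defect is constant on orbits -/

include A

/-- **The lamp-part increment is orbit independent**: `Φ(lam(α γ)) − Φ(lam γ) = Φ(lam(α 1))` for every `γ` — the left rule and the sign relation make the
`Φ`-increment of moving one lamp the same before and after `α`. [folklore] -/
theorem linear_lam_smul (φ : Γ → Fin 2 → ℤ) (c : 𝒜 → Fin 2 → ℤ) (hφ : ∀ (α : 𝒜) (γ : Γ), φ (α • γ) = φ γ + c α)
    {T : ℕ} (hT : ∀ m ∈ F.L, ∃ β : 𝒜, ∀ γ : Γ, β • γ = m ^ T * γ) (α : 𝒜) (γ : Γ) :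
    (φ (F.lam (α • γ) ^ T) - φ 1) - (φ (F.lam γ ^ T) - φ 1) = φ (F.lam (α • 1) ^ T) - φ 1 := by
  -- `D γ := Φ(lam(α γ)) − Φ(lam γ)` is invariant under left multiplication by lamps …
  have key : ∀ y ∈ Subgroup.closure {y : Γ | ∃ h ∈ F.H, y = h * F.s * h⁻¹}, ∀ δ : Γ,
      (φ (F.lam (α • (y * δ)) ^ T) - φ 1) - (φ (F.lam (y * δ) ^ T) - φ 1) =
        (φ (F.lam (α • δ) ^ T) - φ 1) - (φ (F.lam δ ^ T) - φ 1) := by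
    intro y hy
    refine Subgroup.closure_induction (p := fun y _ => ∀ δ : Γ,
      (φ (F.lam (α • (y * δ)) ^ T) - φ 1) - (φ (F.lam (y * δ) ^ T) - φ 1) =
        (φ (F.lam (α • δ) ^ T) - φ 1) - (φ (F.lam δ ^ T) - φ 1)) ?_ ?_ ?_ ?_ hy
    · rintro y ⟨h, hh, rfl⟩ δ
      have hxL : h * F.s * h⁻¹ ∈ F.L := F.conj_mem_L F.s_mem h
      have hyL : A.treePart α * h * F.s * (A.treePart α * h)⁻¹ ∈ F.L := F.conj_mem_L F.s_mem _
      have e1 : α • (h * F.s * h⁻¹ * δ) = (A.treePart α * h * F.s * (A.treePart α * h)⁻¹) ^ A.sgn α h * (α • δ) := by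
        have := A.smul_conj_zpow_mul α hh δ 1; rwa [zpow_one, mul_one] at this
      rw [e1, (F.lam_tr_mul_of_mem_L (F.L.zpow_mem hyL _) _).1, (F.lam_tr_mul_of_mem_L hxL δ).1,
        linear_mul φ c hφ hT (F.L.zpow_mem hyL _) (F.lam_mem _), linear_mul φ c hφ hT hxL (F.lam_mem δ),
        linear_zpow φ c hφ hT hyL, A.linear_conj φ c hφ hT α hh]
      abel
    · intro δ; rw [one_mul]
    · intro x y _ _ hx hy δ; rw [mul_assoc, hx, hy]
    · intro x _ hx δ
      have := hx (x⁻¹ * δ)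
      rw [mul_inv_cancel_left] at this
      exact this.symm
  -- … and under right multiplication by the tree part; so evaluate at `γ = lam γ · tr γ`
  have eγ := F.lam_mul_tr γ
  have e2 : F.lam (α • γ) = F.lam (α • F.lam γ) := by
    conv_lhs => rw [← eγ, A.smul_mul_of_mem_H α _ (F.tr_mem γ)]
    exact (F.lam_tr_mul_of_mem_H _ (F.tr_mem γ)).1
  have e3 : F.lam γ = F.lam (F.lam γ) := ((F.lam_tr_of_mem_L (F.lam_mem γ)).1).symm
  have h4 := key (F.lam γ) (F.gen _ (F.lam_mem γ)) 1
  rw [mul_one, ← e2, ← e3, (F.lam_tr_of_mem_L F.L.one_mem).1, one_pow, sub_self, sub_zero] at h4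
  exact h4

/-- **THE DEFECT IS CONSTANT ON ORBITS.**  With `h γ := T • φ γ − Φ(lam γ)`: `h(α γ) = h γ` for every `α ∈ 𝒜` and `γ` — the difference `κ α` is a
homomorphism `𝒜 → ℤ²` that kills pure translations, squares of tree-trivial elements, hence (torsion of `H`) everything. [folklore] -/
theorem defect_smul (φ : Γ → Fin 2 → ℤ) (c : 𝒜 → Fin 2 → ℤ) (hφ : ∀ (α : 𝒜) (γ : Γ), φ (α • γ) = φ γ + c α)
    {T : ℕ} (hTH : ∀ h ∈ F.H, ∃ β : 𝒜, ∀ γ : Γ, β • γ = (h * F.s * h⁻¹) ^ T * γ) (α : 𝒜) (γ : Γ) :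
    T • φ (α • γ) - (φ (F.lam (α • γ) ^ T) - φ 1) = T • φ γ - (φ (F.lam γ ^ T) - φ 1) := by
  have hT : ∀ m ∈ F.L, ∃ β : 𝒜, ∀ γ : Γ, β • γ = m ^ T * γ := fun m hm => exists_translation_pow_of_mem_L hTH hm
  -- the defect difference `κ`
  let κ : 𝒜 → Fin 2 → ℤ := fun α => T • c α - (φ (F.lam (α • 1) ^ T) - φ 1)
  have hκ : ∀ (α : 𝒜) (γ : Γ), (T • φ (α • γ) - (φ (F.lam (α • γ) ^ T) - φ 1)) - (T • φ γ - (φ (F.lam γ ^ T) - φ 1)) = κ α := by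
    intro α γ
    show _ = T • c α - (φ (F.lam (α • 1) ^ T) - φ 1)
    rw [← A.linear_lam_smul φ c hφ hT α γ, hφ, smul_add]; abel
  -- `κ` is a homomorphism
  have hκmul : ∀ α β : 𝒜, κ (α * β) = κ α + κ β := by
    intro α β
    rw [← hκ (α * β) 1, ← hκ α (β • 1), ← hκ β 1, mul_smul]; abel
  have hκpow : ∀ (α : 𝒜) (n : ℕ), κ (α ^ n) = n • κ α := by
    intro α n
    induction n with
    | zero =>
      rw [pow_zero, zero_smul, ← hκ 1 1, one_smul, sub_self]
    | succ n ih => rw [pow_succ, hκmul, ih, succ_nsmul]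
  -- `κ` kills pure translations by lamps
  have hκtrans : ∀ (β : 𝒜) (m : Γ), m ∈ F.L → (∀ γ : Γ, β • γ = m * γ) → κ β = 0 := by
    intro β m hm hβ
    rw [← hκ β 1, hβ, (F.lam_tr_mul_of_mem_L hm 1).1, (F.lam_tr_of_mem_L F.L.one_mem).1, mul_one, one_pow,
      sub_self, sub_zero]
    -- `T • (φ m − φ 1) = Φ m`
    have h1 := char_pow_of_translation φ c hφ hβ T 1
    rw [mul_one] at h1
    have h2 := char_of_translation φ c hφ hβ 1
    rw [mul_one] at h2
    rw [h1, ← h2, smul_sub]; abel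
  -- `κ` kills tree-trivial elements (their squares are pure translations)
  have hκtree : ∀ β : 𝒜, A.treePart β = 1 → κ β = 0 := by
    intro β hβ
    obtain ⟨m₂, hm₂, h2⟩ := A.exists_sq_smul_eq_mul hβ
    have e := hκtrans (β * β) m₂ hm₂ h2
    rw [hκmul] at e
    have : (2 : ℕ) • κ β = 0 := by rw [two_nsmul]; exact e
    exact eq_zero_of_nsmul_eq_zero (by norm_num) this
  -- `κ` kills everything
  have hκzero : κ α = 0 := by
    obtain ⟨n, hn, hTn⟩ := A.exists_pow_treePart_eq_one α
    have e := hκtree _ hTn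
    rw [hκpow] at e
    exact eq_zero_of_nsmul_eq_zero hn.ne' e
  have := hκ α γ
  rw [hκzero] at this
  exact sub_eq_zero.mp this

/-! ### §3 The no-go -/

/-- **THE AUT-LEVEL ONE-LAMP NO-GO.**  `F : OneLampFrame Γ`; `𝒜` any group acting on `Γ` by LABEL-PRESERVING bijections (`A : F.LabelAction 𝒜`) with
FINITELY MANY ORBITS (`𝒜·R = Γ`, `R` finite); `φ : Γ → ℤ²` with `φ(α·γ) = φ γ + c α`; `N ≥ 1`.  Then the exact single-edge step condition — at EVERY vertex
`γ`, for each axis `i` and sign `σ`, some letter `x ∈ H ∪ {s, s⁻¹}` has `φ(γ x) = φ γ + N σ eᵢ` — FAILS.  (No finite-index, normality, or `𝒜 ≤ Γ` hypothesis: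
this is the one-lamp no-go for EVERY group of label-preserving automorphisms — caveat (α) of `P3-NILPOTENT` §26–§28.)  Lane record `P3-NILPOTENT.md` §29.
[folklore] -/
theorem no_single_edge_steps (R : Finset Γ) (hRc : ∀ γ : Γ, ∃ α : 𝒜, ∃ r ∈ R, α • r = γ)
    (φ : Γ → Fin 2 → ℤ) (c : 𝒜 → Fin 2 → ℤ) (hφ : ∀ (α : 𝒜) (γ : Γ), φ (α • γ) = φ γ + c α) (N : ℕ) (hN : 1 ≤ N)
    (hstep : ∀ (γ : Γ) (i : Fin 2) (σ : ℤˣ), ∃ x : Γ, (x ∈ F.H ∨ x = F.s ∨ x = F.s⁻¹) ∧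
      φ (γ * x) = φ γ + Pi.single i ((N : ℤ) * σ)) : False := by
  classical
  -- the uniform exponent and the defect
  obtain ⟨T, hT1, hTH⟩ := A.exists_uniform_translation R hRc
  have hT : ∀ m ∈ F.L, ∃ β : 𝒜, ∀ γ : Γ, β • γ = m ^ T * γ := fun m hm => exists_translation_pow_of_mem_L hTH hm
  obtain ⟨Φ, hΦ⟩ : ∃ Φ : Γ → (Fin 2 → ℤ), ∀ m, Φ m = φ (m ^ T) - φ 1 := ⟨fun m => φ (m ^ T) - φ 1, fun _ => rfl⟩
  have Φ_mul : ∀ m₁ ∈ F.L, ∀ m₂ ∈ F.L, Φ (m₁ * m₂) = Φ m₁ + Φ m₂ := fun m₁ hm₁ m₂ hm₂ => by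
    rw [hΦ, hΦ, hΦ]; exact linear_mul φ c hφ hT hm₁ hm₂
  have Φ_inv : ∀ m ∈ F.L, Φ m⁻¹ = -Φ m := fun m hm => by rw [hΦ, hΦ]; exact linear_inv φ c hφ hT hm
  obtain ⟨hd, hhd⟩ : ∃ hd : Γ → (Fin 2 → ℤ), ∀ γ, hd γ = T • φ γ - Φ (F.lam γ) :=
    ⟨fun γ => T • φ γ - Φ (F.lam γ), fun _ => rfl⟩
  have hd_smul : ∀ (α : 𝒜) (γ : Γ), hd (α • γ) = hd γ := fun α γ => by
    rw [hhd, hhd, hΦ, hΦ]; exact A.defect_smul φ c hφ hTH α γ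
  -- the index set
  obtain ⟨α₁, r₁, hr₁, -⟩ := hRc 1
  haveI : Nonempty ↥R := ⟨⟨r₁, hr₁⟩⟩
  have hnext : ∀ (r : ↥R) (y : Γ), ∃ r' : ↥R, ∃ α : 𝒜, α • (r' : Γ) = (r : Γ) * y := by
    intro r y
    obtain ⟨α, r', hr', he⟩ := hRc ((r : Γ) * y)
    exact ⟨⟨r', hr'⟩, α, he⟩
  choose sp spa hsp using fun r : ↥R => hnext r F.s
  choose sm sma hsm using fun r : ↥R => hnext r F.s⁻¹
  let h : ↥R → (Fin 2 → ℤ) := fun r => hd r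
  let m : ↥R → (Fin 2 → ℤ) := fun r => Φ (F.pos r)
  have hTN : 1 ≤ T * N := Nat.one_le_iff_ne_zero.2 (Nat.mul_ne_zero (by omega) (by omega))
  have hscale : ∀ (i : Fin 2) (σ : ℤˣ), T • (Pi.single i ((N : ℤ) * σ) : Fin 2 → ℤ) = Pi.single i (((T * N : ℕ) : ℤ) * σ) := by
    intro i σ
    ext j
    by_cases hj : j = i
    · subst hj; simp [mul_assoc]
    · simp [hj]
  -- representatives of the same vertex have the same defect
  have hrep : ∀ (r₁ r₂ : Γ) (a₁ a₂ : 𝒜), a₁ • r₁ = a₂ • r₂ → hd r₁ = hd r₂ := by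
    intro r₁ r₂ a₁ a₂ e
    rw [← hd_smul a₁ r₁, e, hd_smul]
  refine OneLampNoGo.no_four_directions h m sp sm (T * N) hTN fun r i σ => ?_
  obtain ⟨x, hx, hφx⟩ := hstep r i σ
  obtain ⟨α, r', hr', he⟩ := hRc ((r : Γ) * x)
  -- the scaled increment: `T•(φ(r x) − φ r) = Φ(lam(r x)) − Φ(lam r) + (h r′ − h r)`
  have hinc : Pi.single i (((T * N : ℕ) : ℤ) * σ) = (Φ (F.lam ((r : Γ) * x)) - Φ (F.lam r)) + (hd r' - hd r) := by
    have hdx : hd ((r : Γ) * x) = hd r' := by rw [← he, hd_smul]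
    rw [← hdx, hhd, hhd, ← hscale, hφx, smul_add]; abel
  rcases hx with hxH | hxs | hxs
  · -- tree letter: zero-drift slot
    refine Or.inl ⟨⟨r', hr'⟩, ?_⟩
    show hd r' - hd r = _
    rw [hinc, (F.lam_tr_mul_of_mem_H _ hxH).1, sub_self, zero_add]
  · -- the lamp letter forward
    refine Or.inr (Or.inl ?_)
    show Φ (F.pos r) + (hd (sp r) - hd r) = _
    rw [hxs] at he hinc
    have e1 : F.lam ((r : Γ) * F.s) = F.pos r * F.lam r := by rw [F.mul_s_eq, (F.lam_tr_mul_of_mem_L (F.pos_mem _) _).1]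
    rw [hinc, e1, Φ_mul _ (F.pos_mem _) _ (F.lam_mem _), hrep _ _ (spa r) α (by rw [hsp, he])]
    abel
  · -- the lamp letter backward
    refine Or.inr (Or.inr ?_)
    show -Φ (F.pos r) + (hd (sm r) - hd r) = _
    rw [hxs] at he hinc
    have e1 : F.lam ((r : Γ) * F.s⁻¹) = (F.pos r)⁻¹ * F.lam r := by
      have := F.mul_s_zpow_eq (r : Γ) (-1)
      rw [zpow_neg, zpow_one, zpow_neg, zpow_one] at this
      rw [this, (F.lam_tr_mul_of_mem_L (F.L.inv_mem (F.pos_mem _)) _).1]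
    rw [hinc, e1, Φ_mul _ (F.L.inv_mem (F.pos_mem _)) _ (F.lam_mem _), Φ_inv _ (F.pos_mem _),
      hrep _ _ (sma r) α (by rw [hsm, he])]
    abel

end LabelAction

end OneLampFrame

end Summit.CriticalPhenomena.PercolationContinuityZ3.Theorems.Transplant
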